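import Mathlib
import HarnessLib
import Literature.MathematicalPhysics.QuantumLattice.HubbardSectorGridOverlapReindex
import Summits.HubbardSuperconductivity.HubbardSuperconductivity.Theorems.KLProgrammeKLRegimeEngineScaleZeroValues
import Summits.HubbardSuperconductivity.HubbardSuperconductivity.Theorems.KLProgrammeKLRegimeSplitPredicatesV2

/-!
# K3 ENGINE child (stmt-HubbardSuperconductivity-19855), stub `stub_engine_scale0`, clause (E5-S)₀: the FIXED-TUPLE cross-grid Young
# inequality and the scale-`0` isotropic fixed-tuple `L¹` size at every resolution `m`, modulo ONE torus `ℓ¹` bound `T(m)` per sector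

Cell gate-hubbard-kl, seat p3 (g6).  (E5-S)₀ `IsoTupleL1AtS … 0` is about `fixedTupleL1 β 3 (klIsoKernelAt … 0 m) Ω x₁` — the
`L¹` size of the scale-`0` quartic kernel sectorised with the ISOTROPIC family at resolution `m ≥ 0`, one leg pinned, one FIXED sector
tuple `Ω` (no sector sums).  The cross-grid Young inequality of `HubbardGridSectorisedYoung` (p3 g5) is for the sector-SUMMED norm
(`B` sums over all labels); here its fixed-tuple twin, whose constants are PER-SECTOR transfer sizes and hence resolution-uniform:

* **`fixedTupleL1_map_hubbardGridSub_le`** — for any grid polynomial `F` (pinned degree-`(m+1)` norm `≤ K` at slot `0`), any multiplier family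
  and any tuple `Ω`: `fixedTupleL1 β m (sectorisedKernel β Fam (map S F) (m+1)) Ω x₁ ≤ B′^m · D · K`, where `B′ ≥ ε_x·Σ_x |Φ_ℓ(x;Y)|` and
  `D ≥ Σ_Y |Φ_ℓ(x;Y)|` for every SINGLE label `ℓ` (`Φ = gridLegTransfer`, `ε_x = imagTimeWeight β M`);
* `gridLegTransfer_eq_sectorAnalysis_mul_hubbardGridSub` — the transfer function IS the entry of k3c2-p1's overlap kernel `E_F · S_N`, so
  both sizes come from ONE product-torus `ℓ¹` bound `T` (`HubbardSectorGridOverlapReindex`: rows `= T`-expression, single-sector columns `≤` it):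
  `sum_norm_gridLegTransfer_le_of_torusSum` (`D ≤ T`), `imagTimeWeight_mul_sum_norm_gridLegTransfer_le_of_torusSum` (`B′ ≤ ε_x·T`),
  **`fixedTupleL1_map_hubbardGridSub_le_of_torusSum`** (`≤ (ε_x T)^m · T · K` on the `4M` grid);
* `fixedTupleL1_add_le` — subadditivity;
* **`fixedTupleL1_klIsoKernelAt_zero_le_of_torusSum`** — the scale-`0` action split as bare grid vertex + second-order remainder
  (`klEffectiveAction_zero_eq_map_hubbardGridSub`, `klsv_sum_norm_kernel_gridVertex_le`, `GrassmannFlowStepDB.sum_norm_kernel_four_effAction_sub_le_of_gramBounded`):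
  for every `m`, every tuple `Ω` of isotropic resolution-`m` labels and every `x₁`,
  `fixedTupleL1 β 3 (klIsoKernelAt … 0 m) Ω x₁ ≤ (ε_x T)³ · T · (|U||β|/N + ρ⁻⁴·e‖Ṽ‖_h·θ/(1−θ))`, `N = 4M`, given the step data
  (`IsGramBoundedR (SᵀC₀S) κ`, row/column sums `≤ α`, degree-`2` size `N₁`, `θ < 1`) of `…EngineScaleZeroValues` and a torus bound `T`
  for the family `klIsoFamily … klE0 m`.

What remains for (E5-S)₀ after this file: the torus bound `T(m)` with `ε_x·T(m)` UNIFORM in `m` (the isotropic sector lemma: symbol layer of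
`klIsoFamily … m` — radial scale `m`, angular index `2m` — through `torusSum_le_of_symbol_bounds`/the p4 lane's sampled-symbol lemmas), and the
`B`-absorption assembly (`…EngineScaleZeroIsoTuple`).  Everything here is proved; no definitions, no named facts, no sorry.
-/

noncomputable section

namespace Summit.HubbardSuperconductivity.HubbardSuperconductivity.Theorems.EngineV8

set_option linter.dupNamespace false -- summit = problem name (single-conjunct summit), D-0017

open Real Finset Literature.MathematicalPhysics.QuantumLattice Literature.Probability.LatticeModels
open Literature.MathematicalPhysics.QuantumLattice.GrassmannAlgebra
open Summit.HubbardSuperconductivity.HubbardSuperconductivity.Theorems.KLRegimeSplit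
open Summit.HubbardSuperconductivity.HubbardSuperconductivity.Theorems.KLProgrammeLegKernels
open scoped ComplexConjugate

variable {L M : ℕ} [NeZero L]

/-! ## §1 The fixed-tuple Young inequality on any grid -/

/-- **Subadditivity of the fixed-tuple size.** -/
theorem fixedTupleL1_add_le [NeZero M] {Ns m : ℕ} {β : ℝ} (hβ : 0 ≤ β)
    (W₁ W₂ : (Fin (m + 1) → SectorLeg Ns) → (Fin (m + 1) → SpaceTimeIdx L M) → ℂ) (Ω : Fin (m + 1) → SectorLeg Ns)
    (x₁ : SpaceTimeIdx L M) :
    fixedTupleL1 L M β m (W₁ + W₂) Ω x₁ ≤ fixedTupleL1 L M β m W₁ Ω x₁ + fixedTupleL1 L M β m W₂ Ω x₁ := by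
  unfold fixedTupleL1
  rw [← mul_add, ← sum_add_distrib]
  exact mul_le_mul_of_nonneg_left (sum_le_sum fun x _ => norm_add_le _ _) (pow_nonneg (imagTimeWeight_nonneg hβ M) m)

/-- Factorisation of the leg products over a tuple with leg `0` pinned: `Σ_{x : Fin m → P} ∏_i f_i((x₁ :: x)_i) = f₀(x₁) · ∏_j Σ_y f_{j+1}(y)`. -/
theorem sum_prod_vecCons_eq {P : Type*} [Fintype P] {m : ℕ} (f : Fin (m + 1) → P → ℝ) (x₁ : P) :
    ∑ x : Fin m → P, ∏ i : Fin (m + 1), f i (Matrix.vecCons x₁ x i) = f 0 x₁ * ∏ j : Fin m, ∑ y : P, f j.succ y := by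
  have h : ∀ x : Fin m → P, ∏ i : Fin (m + 1), f i (Matrix.vecCons x₁ x i) = f 0 x₁ * ∏ j : Fin m, f j.succ (x j) := by
    intro x
    rw [Fin.prod_univ_succ]
    simp only [Matrix.cons_val_zero, Matrix.cons_val_succ]
  simp_rw [h]
  rw [← mul_sum, Fintype.prod_sum]

/-- **The fixed-tuple cross-grid Young inequality.**  Let `F` be a polynomial of the `N`-grid algebra whose degree-`(m+1)` kernel has pinned
`ℓ¹` norm `≤ K` at slot `0`, and let the sector transfer functions of the family `Fam` satisfy, for every SINGLE label `ℓ`,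
`ε_x·Σ_x |Φ_ℓ(x;Y)| ≤ B′` (every grid leg `Y`) and `Σ_Y |Φ_ℓ(x;Y)| ≤ D` (every `x`).  Then for every tuple `Ω` and every `x₁`,
`fixedTupleL1 β m (sectorisedKernel β Fam (map S F) (m+1)) Ω x₁ ≤ B′^m · D · K`. -/
theorem fixedTupleL1_map_hubbardGridSub_le [NeZero M] {Ns N m : ℕ} {β : ℝ} (hβ : 0 ≤ β) (Fam : Fin Ns → FreqMomentum L M → ℂ)
    (F : GrassmannAlgebra ℂ (GridLeg (GridPoint L N))) (Ω : Fin (m + 1) → SectorLeg Ns) (x₁ : SpaceTimeIdx L M) {B' D K : ℝ}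
    (hB0 : 0 ≤ B') (hK0 : 0 ≤ K)
    (hB' : ∀ (ℓ : SectorLeg Ns) (Y : GridLeg (GridPoint L N)),
      imagTimeWeight β M * ∑ x : SpaceTimeIdx L M, ‖gridLegTransfer L M N β Fam ℓ x Y‖ ≤ B')
    (hD : ∀ (ℓ : SectorLeg Ns) (x : SpaceTimeIdx L M), ∑ Y : GridLeg (GridPoint L N), ‖gridLegTransfer L M N β Fam ℓ x Y‖ ≤ D)
    (hK : ∀ w : GridLeg (GridPoint L N),
      ∑ Y ∈ univ.filter (fun Y : Fin (m + 1) → GridLeg (GridPoint L N) => Y 0 = w), ‖kernel ℂ F (m + 1) Y‖ ≤ K) :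
    fixedTupleL1 L M β m (sectorisedKernel L M β Fam (ExteriorAlgebra.map (Matrix.toLin' (hubbardGridSub L M β N)) F) (m + 1)) Ω x₁ ≤
      B' ^ m * D * K := by
  have hε : 0 ≤ imagTimeWeight β M := imagTimeWeight_nonneg hβ M
  set Φ := gridLegTransfer L M N β Fam with hΦ
  set k : (Fin (m + 1) → GridLeg (GridPoint L N)) → ℂ := fun Y => kernel ℂ F (m + 1) Y with hk
  unfold fixedTupleL1
  -- pointwise bound of the sectorised kernel of the image
  have h1 : ∀ x : Fin m → SpaceTimeIdx L M,
      ‖sectorisedKernel L M β Fam (ExteriorAlgebra.map (Matrix.toLin' (hubbardGridSub L M β N)) F) (m + 1) Ω (Matrix.vecCons x₁ x)‖ ≤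
        ∑ Y : Fin (m + 1) → GridLeg (GridPoint L N), (∏ i, ‖Φ (Ω i) (Matrix.vecCons x₁ x i) (Y i)‖) * ‖k Y‖ := fun x =>
    norm_sectorisedKernel_map_hubbardGridSub_le β Fam F (m + 1) Ω _
  -- the leg sums factorise, for each grid tuple `Y`
  have h2 : ∀ Y : Fin (m + 1) → GridLeg (GridPoint L N),
      imagTimeWeight β M ^ m * ∑ x : Fin m → SpaceTimeIdx L M, ∏ i, ‖Φ (Ω i) (Matrix.vecCons x₁ x i) (Y i)‖ =
        ‖Φ (Ω 0) x₁ (Y 0)‖ * ∏ j : Fin m, (imagTimeWeight β M * ∑ y : SpaceTimeIdx L M, ‖Φ (Ω j.succ) y (Y j.succ)‖) := by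
    intro Y
    rw [sum_prod_vecCons_eq (fun i y => ‖Φ (Ω i) y (Y i)‖) x₁, prod_mul_distrib, prod_const, card_univ, Fintype.card_fin]
    ring
  have h3 : ∀ Y : Fin (m + 1) → GridLeg (GridPoint L N),
      imagTimeWeight β M ^ m * ∑ x : Fin m → SpaceTimeIdx L M, ∏ i, ‖Φ (Ω i) (Matrix.vecCons x₁ x i) (Y i)‖ ≤
        ‖Φ (Ω 0) x₁ (Y 0)‖ * B' ^ m := by
    intro Y
    rw [h2 Y]
    refine mul_le_mul_of_nonneg_left ?_ (norm_nonneg _)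
    calc ∏ j : Fin m, (imagTimeWeight β M * ∑ y : SpaceTimeIdx L M, ‖Φ (Ω j.succ) y (Y j.succ)‖) ≤ ∏ _j : Fin m, B' :=
          prod_le_prod (fun j _ => mul_nonneg hε (sum_nonneg fun _ _ => norm_nonneg _)) fun j _ => hB' _ _
      _ = B' ^ m := by rw [prod_const, card_univ, Fintype.card_fin]
  -- assemble
  calc imagTimeWeight β M ^ m * ∑ x : Fin m → SpaceTimeIdx L M,
        ‖sectorisedKernel L M β Fam (ExteriorAlgebra.map (Matrix.toLin' (hubbardGridSub L M β N)) F) (m + 1) Ω (Matrix.vecCons x₁ x)‖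
      ≤ imagTimeWeight β M ^ m * ∑ x : Fin m → SpaceTimeIdx L M,
          ∑ Y : Fin (m + 1) → GridLeg (GridPoint L N), (∏ i, ‖Φ (Ω i) (Matrix.vecCons x₁ x i) (Y i)‖) * ‖k Y‖ :=
        mul_le_mul_of_nonneg_left (sum_le_sum fun x _ => h1 x) (pow_nonneg hε m)
    _ = ∑ Y : Fin (m + 1) → GridLeg (GridPoint L N), ‖k Y‖ *
          (imagTimeWeight β M ^ m * ∑ x : Fin m → SpaceTimeIdx L M, ∏ i, ‖Φ (Ω i) (Matrix.vecCons x₁ x i) (Y i)‖) := by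
        rw [sum_comm, mul_sum]
        refine sum_congr rfl fun Y _ => ?_
        rw [mul_sum, mul_sum, mul_sum]
        exact sum_congr rfl fun x _ => by ring
    _ ≤ ∑ Y : Fin (m + 1) → GridLeg (GridPoint L N), ‖k Y‖ * (‖Φ (Ω 0) x₁ (Y 0)‖ * B' ^ m) :=
        sum_le_sum fun Y _ => mul_le_mul_of_nonneg_left (h3 Y) (norm_nonneg _)
    _ = B' ^ m * ∑ Y : Fin (m + 1) → GridLeg (GridPoint L N), ‖Φ (Ω 0) x₁ (Y 0)‖ * ‖k Y‖ := by
        rw [mul_sum]; exact sum_congr rfl fun Y _ => by ring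
    _ = B' ^ m * ∑ w : GridLeg (GridPoint L N), ‖Φ (Ω 0) x₁ w‖ *
          ∑ Y ∈ univ.filter (fun Y : Fin (m + 1) → GridLeg (GridPoint L N) => Y 0 = w), ‖k Y‖ := by
        congr 1
        rw [← Finset.sum_fiberwise_of_maps_to (s := (univ : Finset (Fin (m + 1) → GridLeg (GridPoint L N))))
          (t := (univ : Finset (GridLeg (GridPoint L N)))) (g := fun Y => Y 0) (fun Y _ => mem_univ _)]
        refine sum_congr rfl fun w _ => ?_
        rw [mul_sum]
        refine sum_congr rfl fun Y hY => ?_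
        rw [(mem_filter.1 hY).2]
    _ ≤ B' ^ m * ∑ w : GridLeg (GridPoint L N), ‖Φ (Ω 0) x₁ w‖ * K :=
        mul_le_mul_of_nonneg_left (sum_le_sum fun w _ => mul_le_mul_of_nonneg_left (hK w) (norm_nonneg _)) (pow_nonneg hB0 m)
    _ = B' ^ m * K * ∑ w : GridLeg (GridPoint L N), ‖Φ (Ω 0) x₁ w‖ := by rw [← sum_mul]; ring
    _ ≤ B' ^ m * K * D := mul_le_mul_of_nonneg_left (hD _ _) (by positivity)
    _ = B' ^ m * D * K := by ring

/-! ## §2 The transfer function is the entry of the overlap kernel `E_F · S_N`; sizes from ONE torus bound -/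

/-- **`gridLegTransfer = (E_F · S_N)` entrywise**: the sector transfer function of p3's Young inequality is the entry of k3c2-p1's overlap
kernel `sectorAnalysisMatrix β Fam * hubbardGridSub β N` at `((x, ℓ), Y)`. -/
theorem gridLegTransfer_eq_sectorAnalysis_mul_hubbardGridSub {Ns N : ℕ} (β : ℝ) (Fam : Fin Ns → FreqMomentum L M → ℂ)
    (ℓ : SectorLeg Ns) (x : SpaceTimeIdx L M) (Y : GridLeg (GridPoint L N)) :
    gridLegTransfer L M N β Fam ℓ x Y = (sectorAnalysisMatrix L M β Fam * hubbardGridSub L M β N) (x, ℓ) Y := by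
  rw [hubbardGridSub, sectorAnalysis_mul_gridSub_apply, gridLegTransfer, hubbardGridSub]
  by_cases h : Y.1.2 = ℓ.1.2 ∧ Y.2 = ℓ.2
  · rw [if_pos h]
    refine sum_congr rfl fun k _ => ?_
    rw [gridSubMatrix_apply, if_pos ⟨h.1.symm, h.2.symm⟩]
  · rw [if_neg h]
    refine sum_eq_zero fun k _ => ?_
    rw [gridSubMatrix_apply, if_neg (fun h' => h ⟨h'.1.symm, h'.2.symm⟩), mul_zero]

/-- **`D` from the torus bound**: on the `4M` grid, `Σ_Y |Φ_ℓ(x;Y)| ≤ T` whenever every product-torus `ℓ¹` sum of the family is `≤ T`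
(only the grid legs with the spin and charge of `ℓ` contribute; `rowSum_norm_sectorAnalysis_mul_hubbardGridSub_eq`). -/
theorem sum_norm_gridLegTransfer_le_of_torusSum [NeZero M] {Ns : ℕ} {β : ℝ} (hβ : β ≠ 0) (Fam : Fin Ns → FreqMomentum L M → ℂ)
    {T : ℝ}
    (hT : ∀ (ω : Fin Ns) (c : Fin 2), 1 / (|β| * (L : ℝ) ^ 2) *
        ∑ dw : TorusSite 1 (2 * (2 * M)) × TorusSite 2 L, ‖∑ k : FreqMomentum L M, Fam ω k *
          (if c = 0 then torusChar (fun _ : Fin 1 => ((k.1 : ℕ) : ZMod (2 * (2 * M)))) dw.1 * torusChar k.2 dw.2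
            else conj (torusChar (fun _ : Fin 1 => ((k.1 : ℕ) : ZMod (2 * (2 * M)))) dw.1 * torusChar k.2 dw.2))‖ ≤ T)
    (ℓ : SectorLeg Ns) (x : SpaceTimeIdx L M) :
    ∑ Y : GridLeg (GridPoint L (2 * (2 * M))), ‖gridLegTransfer L M (2 * (2 * M)) β Fam ℓ x Y‖ ≤ T := by
  classical
  obtain ⟨⟨ω, σ⟩, c⟩ := ℓ
  -- only the legs `((q, σ), c)` contribute
  have hvan : ∀ Y : GridLeg (GridPoint L (2 * (2 * M))), ¬(Y.1.2 = σ ∧ Y.2 = c) →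
      gridLegTransfer L M (2 * (2 * M)) β Fam ((ω, σ), c) x Y = 0 := by
    intro Y hY
    rw [gridLegTransfer_eq_sectorAnalysis_mul_hubbardGridSub, hubbardGridSub, sectorAnalysis_mul_gridSub_apply, if_neg hY]
  have hsum : ∑ Y : GridLeg (GridPoint L (2 * (2 * M))), ‖gridLegTransfer L M (2 * (2 * M)) β Fam ((ω, σ), c) x Y‖ =
      ∑ q : GridPoint L (2 * (2 * M)),
        ‖(sectorAnalysisMatrix L M β Fam * hubbardGridSub L M β (2 * (2 * M))) (x, ((ω, σ), c)) ((q, σ), c)‖ := by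
    rw [Fintype.sum_prod_type, Fintype.sum_prod_type]
    refine sum_congr rfl fun q _ => ?_
    rw [Fintype.sum_eq_single σ, Fintype.sum_eq_single c, gridLegTransfer_eq_sectorAnalysis_mul_hubbardGridSub]
    · intro c' hc'
      rw [hvan ((q, σ), c') (fun h => hc' h.2), norm_zero]
    · intro σ' hσ'
      exact sum_eq_zero fun c' _ => by rw [hvan ((q, σ'), c') (fun h => hσ' h.1), norm_zero]
  rw [hsum, rowSum_norm_sectorAnalysis_mul_hubbardGridSub_eq hβ]
  exact hT ω c

/-- **`B′` from the torus bound**: on the `4M` grid, `ε_x·Σ_x |Φ_ℓ(x;Y)| ≤ ε_x·T` for every single label `ℓ` and grid leg `Y`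
(`colSum_norm_sectorAnalysis_mul_hubbardGridSub_le`). -/
theorem imagTimeWeight_mul_sum_norm_gridLegTransfer_le_of_torusSum [NeZero M] {Ns : ℕ} {β : ℝ} (hβ : 0 < β)
    (Fam : Fin Ns → FreqMomentum L M → ℂ) {T : ℝ}
    (hT : ∀ (ω : Fin Ns) (c : Fin 2), 1 / (|β| * (L : ℝ) ^ 2) *
        ∑ dw : TorusSite 1 (2 * (2 * M)) × TorusSite 2 L, ‖∑ k : FreqMomentum L M, Fam ω k *
          (if c = 0 then torusChar (fun _ : Fin 1 => ((k.1 : ℕ) : ZMod (2 * (2 * M)))) dw.1 * torusChar k.2 dw.2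
            else conj (torusChar (fun _ : Fin 1 => ((k.1 : ℕ) : ZMod (2 * (2 * M)))) dw.1 * torusChar k.2 dw.2))‖ ≤ T)
    (ℓ : SectorLeg Ns) (Y : GridLeg (GridPoint L (2 * (2 * M)))) :
    imagTimeWeight β M * ∑ x : SpaceTimeIdx L M, ‖gridLegTransfer L M (2 * (2 * M)) β Fam ℓ x Y‖ ≤ imagTimeWeight β M * T := by
  classical
  refine mul_le_mul_of_nonneg_left ?_ (imagTimeWeight_nonneg hβ.le M)
  obtain ⟨⟨ω, σ⟩, c⟩ := ℓ
  obtain ⟨⟨q, σ'⟩, c'⟩ := Y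
  by_cases h : σ' = σ ∧ c' = c
  · obtain ⟨rfl, rfl⟩ := h
    simp_rw [gridLegTransfer_eq_sectorAnalysis_mul_hubbardGridSub]
    exact (colSum_norm_sectorAnalysis_mul_hubbardGridSub_le hβ.ne' Fam q ω σ' c').trans (hT ω c')
  · have hvan : ∀ x : SpaceTimeIdx L M, gridLegTransfer L M (2 * (2 * M)) β Fam ((ω, σ), c) x ((q, σ'), c') = 0 := by
      intro x
      rw [gridLegTransfer_eq_sectorAnalysis_mul_hubbardGridSub, hubbardGridSub, sectorAnalysis_mul_gridSub_apply, if_neg (by exact h)]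
    simp_rw [hvan, norm_zero, sum_const_zero]
    have hT0 : 0 ≤ T := le_trans (by positivity) (hT ω c)
    exact hT0

/-- **The fixed-tuple Young inequality on the `4M` grid from ONE torus bound**: `fixedTupleL1 … ≤ (ε_x·T)^m · T · K`. -/
theorem fixedTupleL1_map_hubbardGridSub_le_of_torusSum [NeZero M] {Ns m : ℕ} {β : ℝ} (hβ : 0 < β)
    (Fam : Fin Ns → FreqMomentum L M → ℂ) (F : GrassmannAlgebra ℂ (GridLeg (GridPoint L (2 * (2 * M)))))
    (Ω : Fin (m + 1) → SectorLeg Ns) (x₁ : SpaceTimeIdx L M) {T K : ℝ} (hT0 : 0 ≤ T) (hK0 : 0 ≤ K)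
    (hT : ∀ (ω : Fin Ns) (c : Fin 2), 1 / (|β| * (L : ℝ) ^ 2) *
        ∑ dw : TorusSite 1 (2 * (2 * M)) × TorusSite 2 L, ‖∑ k : FreqMomentum L M, Fam ω k *
          (if c = 0 then torusChar (fun _ : Fin 1 => ((k.1 : ℕ) : ZMod (2 * (2 * M)))) dw.1 * torusChar k.2 dw.2
            else conj (torusChar (fun _ : Fin 1 => ((k.1 : ℕ) : ZMod (2 * (2 * M)))) dw.1 * torusChar k.2 dw.2))‖ ≤ T)
    (hK : ∀ w : GridLeg (GridPoint L (2 * (2 * M))),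
      ∑ Y ∈ univ.filter (fun Y : Fin (m + 1) → GridLeg (GridPoint L (2 * (2 * M))) => Y 0 = w), ‖kernel ℂ F (m + 1) Y‖ ≤ K) :
    fixedTupleL1 L M β m (sectorisedKernel L M β Fam
      (ExteriorAlgebra.map (Matrix.toLin' (hubbardGridSub L M β (2 * (2 * M)))) F) (m + 1)) Ω x₁ ≤ (imagTimeWeight β M * T) ^ m * T * K :=
  fixedTupleL1_map_hubbardGridSub_le hβ.le Fam F Ω x₁ (mul_nonneg (imagTimeWeight_nonneg hβ.le M) hT0) hK0
    (imagTimeWeight_mul_sum_norm_gridLegTransfer_le_of_torusSum hβ Fam hT) (sum_norm_gridLegTransfer_le_of_torusSum hβ.ne' Fam hT) hK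

/-! ## §3 The scale-`0` isotropic fixed-tuple size at every resolution, modulo the torus bound -/

/-- **The scale-`0` quartic kernel, isotropically sectorised at resolution `m`, has fixed-tuple `L¹` size
`≤ (ε_x T)³ · T · (|U||β|/N + ρ⁻⁴·e‖Ṽ‖_h·θ/(1−θ))`** — bare grid vertex plus the second-order remainder of ONE determinant-bounded step,
each pushed through the fixed-tuple Young inequality with the torus bound `T` of the family `klIsoFamily … klE0 m`; same step data as
`norm_klPairAmplitude_zero_sub_le_of_gridStep` / `klAnisoLegKernelNorm_zero_le_of_gridStep`. -/
theorem fixedTupleL1_klIsoKernelAt_zero_le_of_torusSum [NeZero M] {β : ℝ} (hβ : 0 < β) (U μ : ℝ) (K : TrigPolyC4v)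
    {κ : ℝ} (hκ : 0 < κ)
    (hGB : IsGramBoundedR ((hubbardGridSub L M β (2 * (2 * M))).transpose * hubbardCovAboveCT L M β μ 0 K klE0 *
      hubbardGridSub L M β (2 * (2 * M))) κ)
    {α : ℝ} (hα : 0 < α)
    (hrow : ∀ X, ∑ Y, ‖((hubbardGridSub L M β (2 * (2 * M))).transpose * hubbardCovAboveCT L M β μ 0 K klE0 *
      hubbardGridSub L M β (2 * (2 * M))) X Y‖ ≤ α)
    (hcol : ∀ Y, ∑ X, ‖((hubbardGridSub L M β (2 * (2 * M))).transpose * hubbardCovAboveCT L M β μ 0 K klE0 *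
      hubbardGridSub L M β (2 * (2 * M))) X Y‖ ≤ α)
    {ρ : ℝ} (hρ : 0 < ρ) {N₁ : ℝ} (hN₁ : 0 ≤ N₁)
    (hct : ∀ (j : Fin 2) (w : GridLeg (GridPoint L (2 * (2 * M)))),
      ∑ Y ∈ univ.filter (fun Y : Fin 2 → GridLeg (GridPoint L (2 * (2 * M))) => Y j = w),
        ‖kernel ℂ (hubbardGridCounterQuadratic L (2 * (2 * M)) β K) 2 Y‖ ≤ N₁)
    (hθ : Real.exp 1 * α * normV (GridLeg (GridPoint L (2 * (2 * M)))) κ ρ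
      (fun m' : ℕ => if m' = 1 then N₁ else if m' = 2 then |U| * |β| / (2 * (2 * M) : ℕ) else 0) / κ ^ 2 < 1)
    (m : ℕ) {T : ℝ} (hT0 : 0 ≤ T)
    (hT : ∀ (ω : Fin (sectorCount (2 * m))) (c : Fin 2), 1 / (|β| * (L : ℝ) ^ 2) *
        ∑ dw : TorusSite 1 (2 * (2 * M)) × TorusSite 2 L, ‖∑ k : FreqMomentum L M, klIsoFamily L M β μ K klE0 m ω k *
          (if c = 0 then torusChar (fun _ : Fin 1 => ((k.1 : ℕ) : ZMod (2 * (2 * M)))) dw.1 * torusChar k.2 dw.2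
            else conj (torusChar (fun _ : Fin 1 => ((k.1 : ℕ) : ZMod (2 * (2 * M)))) dw.1 * torusChar k.2 dw.2))‖ ≤ T)
    (Ω : Fin 4 → SectorLeg (sectorCount (2 * m))) (x₁ : SpaceTimeIdx L M) :
    fixedTupleL1 L M β 3 (klIsoKernelAt L M β U μ K 0 m) Ω x₁ ≤
      (imagTimeWeight β M * T) ^ 3 * T *
        (|U| * |β| / (2 * (2 * M) : ℕ) +
          ρ⁻¹ ^ 4 * (Real.exp 1 * normV (GridLeg (GridPoint L (2 * (2 * M)))) κ ρ
              (fun m' : ℕ => if m' = 1 then N₁ else if m' = 2 then |U| * |β| / (2 * (2 * M) : ℕ) else 0)) *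
            (Real.exp 1 * α * normV (GridLeg (GridPoint L (2 * (2 * M)))) κ ρ
              (fun m' : ℕ => if m' = 1 then N₁ else if m' = 2 then |U| * |β| / (2 * (2 * M) : ℕ) else 0) / κ ^ 2) /
            (1 - Real.exp 1 * α * normV (GridLeg (GridPoint L (2 * (2 * M)))) κ ρ
              (fun m' : ℕ => if m' = 1 then N₁ else if m' = 2 then |U| * |β| / (2 * (2 * M) : ℕ) else 0) / κ ^ 2)) := by
  -- notation
  set Ng : ℕ := 2 * (2 * M) with hNg
  haveI : NeZero Ng := ⟨by rw [hNg]; have := NeZero.ne M; omega⟩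
  set S := hubbardGridSub L M β Ng with hS
  set C' := S.transpose * hubbardCovAboveCT L M β μ 0 K klE0 * S with hC'
  set Vt := hubbardGridInteraction L Ng β U + hubbardGridCounterQuadratic L Ng β K with hVt
  set prof : ℕ → ℝ := fun m' : ℕ => if m' = 1 then N₁ else if m' = 2 then |U| * |β| / Ng else 0 with hprof
  set R₄ : ℝ := ρ⁻¹ ^ 4 * (Real.exp 1 * normV (GridLeg (GridPoint L Ng)) κ ρ prof) *
      (Real.exp 1 * α * normV (GridLeg (GridPoint L Ng)) κ ρ prof / κ ^ 2) /
      (1 - Real.exp 1 * α * normV (GridLeg (GridPoint L Ng)) κ ρ prof / κ ^ 2) with hR₄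
  set Fam := klIsoFamily L M β μ K klE0 m with hFam
  have hε : 0 ≤ imagTimeWeight β M := imagTimeWeight_nonneg hβ.le M
  -- (1) the kernel as the sectorisation of the image of `Ṽ + (effAction C′ Ṽ − Ṽ)`
  have hsplit : klIsoKernelAt L M β U μ K 0 m =
      sectorisedKernel L M β Fam (ExteriorAlgebra.map (Matrix.toLin' S) Vt) 4 +
        sectorisedKernel L M β Fam (ExteriorAlgebra.map (Matrix.toLin' S) (effAction ℂ C' Vt - Vt)) 4 := by
    rw [klIsoKernelAt, klEffectiveAction_zero_eq_map_hubbardGridSub hβ.ne' U μ K klE0, ← sectorisedKernel_add, ← map_add, add_sub_cancel]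
  -- (2) the pinned sizes of the two grid polynomials
  have hKbare : ∀ w : GridLeg (GridPoint L Ng),
      ∑ Y ∈ univ.filter (fun Y : Fin 4 → GridLeg (GridPoint L Ng) => Y 0 = w), ‖kernel ℂ Vt 4 Y‖ ≤ |U| * |β| / Ng := by
    intro w
    have h := klsv_sum_norm_kernel_gridVertex_le (L := L) β U K hN₁ hct 2 ⟨0, by norm_num⟩ w
    simpa [hprof] using h
  have hVt_even : Vt ∈ evenPart ℂ (GridLeg (GridPoint L Ng)) :=
    add_mem (hubbardGridInteraction_mem_evenPart β U) (hubbardGridCounterQuadratic_mem_evenPart β K)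
  have hVt0 : constPart ℂ Vt = 0 := by
    rw [hVt, map_add, constPart_hubbardGridInteraction, constPart_hubbardGridCounterQuadratic, add_zero]
  have hKrem : ∀ w : GridLeg (GridPoint L Ng),
      ∑ Y ∈ univ.filter (fun Y : Fin 4 → GridLeg (GridPoint L Ng) => Y 0 = w), ‖kernel ℂ (effAction ℂ C' Vt - Vt) 4 Y‖ ≤ R₄ :=
    fun w => sum_norm_kernel_four_effAction_sub_le_of_gramBounded C' hκ hGB Vt hVt_even hVt0 prof (klsv_profile_nonneg β U Ng hN₁)
      (klsv_sum_norm_kernel_gridVertex_le β U K hN₁ hct) hα hrow hcol hρ hθ (fun m' hm' => klsv_profile_of_two_lt β U Ng N₁ hm') 0 w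
  have hUβ : 0 ≤ |U| * |β| / (Ng : ℝ) := by positivity
  have hR₄0 : 0 ≤ R₄ := le_trans (sum_nonneg fun _ _ => norm_nonneg _) (hKrem (((0, 0), 0), 0))
  -- (3) the two Young bounds
  have hbare := fixedTupleL1_map_hubbardGridSub_le_of_torusSum (m := 3) hβ Fam Vt Ω x₁ hT0 hUβ hT hKbare
  have hrem := fixedTupleL1_map_hubbardGridSub_le_of_torusSum (m := 3) hβ Fam (effAction ℂ C' Vt - Vt) Ω x₁ hT0 hR₄0 hT hKrem
  rw [hsplit]
  refine (fixedTupleL1_add_le hβ.le _ _ Ω x₁).trans ?_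
  calc _ ≤ (imagTimeWeight β M * T) ^ 3 * T * (|U| * |β| / (Ng : ℝ)) + (imagTimeWeight β M * T) ^ 3 * T * R₄ := add_le_add hbare hrem
    _ = _ := by ring

end Summit.HubbardSuperconductivity.HubbardSuperconductivity.Theorems.EngineV8

end
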